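import Summits.Ventures.Crystal3D.Theorems.StickyWulffConstantCoaxialWallLawInPlaneSlotSharp
import HarnessLib

/-!
# Descending along a twin plate: every non-horizontal `{111}` plate of a grain carries an in-plane slot going down

HONEST FRAMING. Part of the venture `Summits/Ventures/Crystal3D` (cell `crystal3d-full`), helper
`--supports` the crux `CoaxialWallLaw` (stmt-Ventures-19481, `route-Ventures-StickyWulffConstant`),
REGISTERED line `WallLedgerF` (planner cf-p1 gen 16), stub `stub_coaxialTwoSlabAdhesion`.  Geometric
input of the «plate foot» lemma (next file: a foreign-twin-capped exit is joined, inside its coherent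
plate, to an unsaturated ball at most `O(1+h)` in-plane steps lower).  Rung credit only; F-C1 not moved.

**Theorem (`exists_descent_farDiff`).**  For a grain frame `A` and a unit MENU normal `n`
(`⟪A w, n⟫ ∈ {0, ±√(2/3)}` for all slots), there are two distinct FAR slots `uᵢ ≠ uⱼ`
(`⟪A uᵢ, n⟫, ⟪A uⱼ, n⟫ > 0`) whose difference — an in-plane slot of the `n`-plate — DESCENDS at rate
`−⟪A(uᵢ − uⱼ), e₃⟫ ≥ (√3/2)·√(1 − ⟪n, e₃⟫²)` (the six in-plane slots form a regular hexagon in the plate;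
the downward direction of the plate has length `√(1 − ⟪n,e₃⟫²)` and lies within `30°` of one of them).
Linear algebra: with `a = A(u₁−u₂)`, `c = A(u₁−u₃)` (unit, at `60°`) and `g = e₃ − ⟪e₃,n⟫ n`, the vector
`g − λa − μc` (`λ = (4x−2y)/3`, `μ = (4y−2x)/3`, `x = ⟪a,e₃⟫`, `y = ⟪c,e₃⟫`) is orthogonal to `a`, `c`, `n`,
hence to `A u₁, A u₂, A u₃` (`A(u₁+u₂+u₃) = √6 n`, `sum_eq_sqrt_six_smul`), hence zero
(`eq_zero_of_inner_eq_zero_of_indep`); so `1 − ⟪n,e₃⟫² = ‖g‖² = (4/3)(x² − xy + y²) ≤ (4/3)·max(x², y², (x−y)²)`.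

WHAT THIS IS NOT: no packing content; F-C1 not moved.
-/

noncomputable section

namespace Summit.Ventures.Crystal3D.Theorems

open Summit.Ventures.Crystal3D Finset
open Literature.MathematicalPhysics.StatisticalMechanics (fccStacking)
open scoped InnerProductSpace

/-- Elementary: `x² − xy + y² ≤ max (x², y², (x − y)²)` as a disjunction. -/
theorem sq_sub_mul_add_sq_le_cases (x y : ℝ) :
    x ^ 2 - x * y + y ^ 2 ≤ x ^ 2 ∨ x ^ 2 - x * y + y ^ 2 ≤ y ^ 2 ∨ x ^ 2 - x * y + y ^ 2 ≤ (x - y) ^ 2 := by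
  by_cases hxy : x * y ≤ 0
  · exact Or.inr (Or.inr (by nlinarith))
  push Not at hxy
  by_cases h : x ^ 2 ≤ y ^ 2
  · refine Or.inr (Or.inl ?_)
    -- `x² ≤ x y` since `x, y` have the same sign and `|x| ≤ |y|`
    have habs : |x| ≤ |y| := sq_le_sq.1 h
    have hxy' : x * y = |x| * |y| := by rw [← abs_mul, abs_of_pos hxy]
    nlinarith [abs_nonneg x, sq_abs x, mul_le_mul_of_nonneg_left habs (abs_nonneg x)]
  · refine Or.inl ?_
    push Not at h
    have habs : |y| ≤ |x| := (sq_lt_sq.1 h).le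
    have hxy' : x * y = |x| * |y| := by rw [← abs_mul, abs_of_pos hxy]
    nlinarith [abs_nonneg y, sq_abs y, mul_le_mul_of_nonneg_left habs (abs_nonneg y)]

/-- `√(2/3) = √6 / 3`. -/
theorem sqrt_two_thirds_eq : Real.sqrt (2 / 3) = Real.sqrt 6 / 3 := by
  rw [show (2 / 3 : ℝ) = 6 / 3 ^ 2 by norm_num, Real.sqrt_div (by norm_num), Real.sqrt_sq (by norm_num)]

/-- **A descending in-plane slot of a non-horizontal plate.**  See the module docstring. -/
theorem exists_descent_farDiff (A : EuclideanSpace ℝ (Fin 3) ≃ₗᵢ[ℝ] EuclideanSpace ℝ (Fin 3))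
    {n : EuclideanSpace ℝ (Fin 3)} (hn : ‖n‖ = 1)
    (hmenu : ∀ w ∈ fccSlots, ⟪A w, n⟫_ℝ = 0 ∨ ⟪A w, n⟫_ℝ = Real.sqrt (2 / 3) ∨ ⟪A w, n⟫_ℝ = -Real.sqrt (2 / 3)) :
    ∃ uᵢ ∈ fccSlots, ∃ uⱼ ∈ fccSlots, uᵢ ≠ uⱼ ∧ 0 < ⟪A uᵢ, n⟫_ℝ ∧ 0 < ⟪A uⱼ, n⟫_ℝ ∧
      Real.sqrt 3 / 2 * Real.sqrt (1 - ⟪n, EuclideanSpace.single (2 : Fin 3) (1 : ℝ)⟫_ℝ ^ 2) ≤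
        -⟪A (uᵢ - uⱼ), EuclideanSpace.single (2 : Fin 3) (1 : ℝ)⟫_ℝ := by
  set e₃ : EuclideanSpace ℝ (Fin 3) := EuclideanSpace.single (2 : Fin 3) (1 : ℝ) with he₃
  have he₃n : ‖e₃‖ = 1 := by rw [he₃, PiLp.norm_single, norm_one]
  have hrpos : 0 < Real.sqrt (2 / 3) := Real.sqrt_pos.2 (by norm_num)
  have hs23 : Real.sqrt (2 / 3) = Real.sqrt 6 / 3 := sqrt_two_thirds_eq
  obtain ⟨u₁, hu₁, u₂, hu₂, u₃, hu₃, hn₁, hn₂, hn₃, i12, i13, i23, hind, -⟩ := exists_far_frame A hn hmenu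
  have h1 := norm_eq_one_of_mem_fccSlots hu₁
  have h2 := norm_eq_one_of_mem_fccSlots hu₂
  have h3 := norm_eq_one_of_mem_fccSlots hu₃
  have p₁ : 0 < ⟪A u₁, n⟫_ℝ := by rw [hn₁]; exact hrpos
  have p₂ : 0 < ⟪A u₂, n⟫_ℝ := by rw [hn₂]; exact hrpos
  have p₃ : 0 < ⟪A u₃, n⟫_ℝ := by rw [hn₃]; exact hrpos
  have d12 : u₁ ≠ u₂ := by
    intro h; rw [h, real_inner_self_eq_norm_sq, h2] at i12; norm_num at i12
  have d13 : u₁ ≠ u₃ := by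
    intro h; rw [h, real_inner_self_eq_norm_sq, h3] at i13; norm_num at i13
  have d23 : u₂ ≠ u₃ := by
    intro h; rw [h, real_inner_self_eq_norm_sq, h3] at i23; norm_num at i23
  -- the table of inner products (both orientations)
  have A11 : ⟪A u₁, A u₁⟫_ℝ = 1 := by rw [LinearIsometryEquiv.inner_map_map, real_inner_self_eq_norm_sq, h1, one_pow]
  have A22 : ⟪A u₂, A u₂⟫_ℝ = 1 := by rw [LinearIsometryEquiv.inner_map_map, real_inner_self_eq_norm_sq, h2, one_pow]
  have A33 : ⟪A u₃, A u₃⟫_ℝ = 1 := by rw [LinearIsometryEquiv.inner_map_map, real_inner_self_eq_norm_sq, h3, one_pow]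
  have A12 : ⟪A u₁, A u₂⟫_ℝ = 1 / 2 := by rw [LinearIsometryEquiv.inner_map_map, i12]
  have A13 : ⟪A u₁, A u₃⟫_ℝ = 1 / 2 := by rw [LinearIsometryEquiv.inner_map_map, i13]
  have A23 : ⟪A u₂, A u₃⟫_ℝ = 1 / 2 := by rw [LinearIsometryEquiv.inner_map_map, i23]
  have A21 : ⟪A u₂, A u₁⟫_ℝ = 1 / 2 := by rw [real_inner_comm]; exact A12
  have A31 : ⟪A u₃, A u₁⟫_ℝ = 1 / 2 := by rw [real_inner_comm]; exact A13
  have A32 : ⟪A u₃, A u₂⟫_ℝ = 1 / 2 := by rw [real_inner_comm]; exact A23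
  have N1 : ⟪n, A u₁⟫_ℝ = Real.sqrt (2 / 3) := by rw [real_inner_comm]; exact hn₁
  have N2 : ⟪n, A u₂⟫_ℝ = Real.sqrt (2 / 3) := by rw [real_inner_comm]; exact hn₂
  have N3 : ⟪n, A u₃⟫_ℝ = Real.sqrt (2 / 3) := by rw [real_inner_comm]; exact hn₃
  have nn : ⟪n, n⟫_ℝ = 1 := by rw [real_inner_self_eq_norm_sq, hn, one_pow]
  have ee : ⟪e₃, e₃⟫_ℝ = 1 := by rw [real_inner_self_eq_norm_sq, he₃n, one_pow]
  have tcomm : ⟪e₃, n⟫_ℝ = ⟪n, e₃⟫_ℝ := real_inner_comm _ _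
  -- `A (u₁ + u₂ + u₃) = √6 n`, read against `e₃`
  have hsum6 : A u₁ + A u₂ + A u₃ = Real.sqrt 6 • n := sum_eq_sqrt_six_smul (A u₁) (A u₂) (A u₃) n
    (by rw [LinearIsometryEquiv.norm_map, h1]) (by rw [LinearIsometryEquiv.norm_map, h2])
    (by rw [LinearIsometryEquiv.norm_map, h3]) hn A12 A13 A23 hn₁ hn₂ hn₃
  have hsumE : ⟪e₃, A u₁⟫_ℝ + ⟪e₃, A u₂⟫_ℝ + ⟪e₃, A u₃⟫_ℝ = Real.sqrt 6 * ⟪n, e₃⟫_ℝ := by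
    have := congrArg (fun v => ⟪e₃, v⟫_ℝ) hsum6
    simp only [inner_add_right, real_inner_smul_right] at this
    rw [tcomm] at this; exact this
  have h62 : Real.sqrt 6 * Real.sqrt (2 / 3) = 2 := by
    rw [← Real.sqrt_mul (by norm_num), show (6 : ℝ) * (2 / 3) = 2 ^ 2 by norm_num, Real.sqrt_sq (by norm_num)]
  -- coordinates (generalised away from their definitions at the end)
  obtain ⟨E₁, hE₁⟩ : ∃ E : ℝ, E = ⟪e₃, A u₁⟫_ℝ := ⟨_, rfl⟩
  obtain ⟨E₂, hE₂⟩ : ∃ E : ℝ, E = ⟪e₃, A u₂⟫_ℝ := ⟨_, rfl⟩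
  obtain ⟨E₃, hE₃⟩ : ∃ E : ℝ, E = ⟪e₃, A u₃⟫_ℝ := ⟨_, rfl⟩
  obtain ⟨t, ht⟩ : ∃ t : ℝ, t = ⟪n, e₃⟫_ℝ := ⟨_, rfl⟩
  rw [← hE₁, ← hE₂, ← hE₃, ← ht] at hsumE
  obtain ⟨x, hx⟩ : ∃ x : ℝ, x = E₁ - E₂ := ⟨_, rfl⟩
  obtain ⟨y, hy⟩ : ∃ y : ℝ, y = E₁ - E₃ := ⟨_, rfl⟩
  -- the residual vector `r = g − λ a − μ c`
  obtain ⟨r, hr⟩ : ∃ r : EuclideanSpace ℝ (Fin 3), r = (e₃ - t • n) - ((4 * x - 2 * y) / 3) • (A u₁ - A u₂) -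
    ((4 * y - 2 * x) / 3) • (A u₁ - A u₃) := ⟨_, rfl⟩
  have expand : ∀ v : EuclideanSpace ℝ (Fin 3), ⟪r, v⟫_ℝ = ⟪e₃, v⟫_ℝ - t * ⟪n, v⟫_ℝ -
      (4 * x - 2 * y) / 3 * (⟪A u₁, v⟫_ℝ - ⟪A u₂, v⟫_ℝ) - (4 * y - 2 * x) / 3 * (⟪A u₁, v⟫_ℝ - ⟪A u₃, v⟫_ℝ) := by
    intro v
    rw [hr]
    simp only [inner_sub_left, real_inner_smul_left]
  have hr1 : ⟪r, A u₁⟫_ℝ = 0 := by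
    rw [expand, ← hE₁, N1, A11, A21, A31, hs23]
    rw [hx, hy]
    linarith [hsumE]
  have hr2 : ⟪r, A u₂⟫_ℝ = 0 := by
    rw [expand, ← hE₂, N2, A12, A22, A32, hs23]
    rw [hx, hy]
    linarith [hsumE]
  have hr3 : ⟪r, A u₃⟫_ℝ = 0 := by
    rw [expand, ← hE₃, N3, A13, A23, A33, hs23]
    rw [hx, hy]
    linarith [hsumE]
  have hr0 : r = 0 := by
    have h0 : A.symm r = 0 := by
      refine eq_zero_of_inner_eq_zero_of_indep hind ?_ ?_ ?_
      · rw [← LinearIsometryEquiv.inner_map_map A, LinearIsometryEquiv.apply_symm_apply, real_inner_comm]; exact hr1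
      · rw [← LinearIsometryEquiv.inner_map_map A, LinearIsometryEquiv.apply_symm_apply, real_inner_comm]; exact hr2
      · rw [← LinearIsometryEquiv.inner_map_map A, LinearIsometryEquiv.apply_symm_apply, real_inner_comm]; exact hr3
    have := congrArg A h0
    rwa [LinearIsometryEquiv.apply_symm_apply, map_zero] at this
  -- `‖g‖² = 1 − t²` and `‖g‖² = λ² + λμ + μ²`
  have hg : e₃ - t • n = ((4 * x - 2 * y) / 3) • (A u₁ - A u₂) + ((4 * y - 2 * x) / 3) • (A u₁ - A u₃) := by
    have h' : (e₃ - t • n) - ((4 * x - 2 * y) / 3) • (A u₁ - A u₂) - ((4 * y - 2 * x) / 3) • (A u₁ - A u₃) = 0 := by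
      rw [← hr]; exact hr0
    rw [sub_sub, sub_eq_zero] at h'
    exact h'
  have hgg : ⟪e₃ - t • n, e₃ - t • n⟫_ℝ = 1 - t ^ 2 := by
    simp only [inner_sub_left, inner_sub_right, real_inner_smul_left, real_inner_smul_right]
    rw [ee, nn, tcomm, ← ht]; ring
  have haa : ⟪A u₁ - A u₂, A u₁ - A u₂⟫_ℝ = 1 := by
    simp only [inner_sub_left, inner_sub_right]; rw [A11, A12, A21, A22]; norm_num
  have hcc : ⟪A u₁ - A u₃, A u₁ - A u₃⟫_ℝ = 1 := by
    simp only [inner_sub_left, inner_sub_right]; rw [A11, A13, A31, A33]; norm_num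
  have hac : ⟪A u₁ - A u₂, A u₁ - A u₃⟫_ℝ = 1 / 2 := by
    simp only [inner_sub_left, inner_sub_right]; rw [A11, A13, A21, A23]; norm_num
  have hca : ⟪A u₁ - A u₃, A u₁ - A u₂⟫_ℝ = 1 / 2 := by rw [real_inner_comm]; exact hac
  have hgg' : ⟪e₃ - t • n, e₃ - t • n⟫_ℝ = 4 / 3 * (x ^ 2 - x * y + y ^ 2) := by
    rw [hg]
    simp only [inner_add_left, inner_add_right, real_inner_smul_left, real_inner_smul_right]
    rw [haa, hac, hca, hcc]
    ring
  have key : 3 / 4 * (1 - t ^ 2) = x ^ 2 - x * y + y ^ 2 := by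
    have := hgg.symm.trans hgg'
    linarith
  -- heights of the three in-plane differences
  have height : ∀ {uᵢ uⱼ : EuclideanSpace ℝ (Fin 3)} {Eᵢ Eⱼ : ℝ}, Eᵢ = ⟪e₃, A uᵢ⟫_ℝ → Eⱼ = ⟪e₃, A uⱼ⟫_ℝ →
      ⟪A (uᵢ - uⱼ), e₃⟫_ℝ = Eᵢ - Eⱼ := by
    intro uᵢ uⱼ Eᵢ Eⱼ hi hj
    rw [map_sub, inner_sub_left, real_inner_comm, ← hi, real_inner_comm, ← hj]
  have hx' : ⟪A (u₁ - u₂), e₃⟫_ℝ = x := by rw [height hE₁ hE₂, hx]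
  have hy' : ⟪A (u₁ - u₃), e₃⟫_ℝ = y := by rw [height hE₁ hE₃, hy]
  have hz' : ⟪A (u₂ - u₃), e₃⟫_ℝ = y - x := by rw [height hE₂ hE₃, hx, hy]; ring
  clear hr1 hr2 hr3 hr0 hg hgg hgg' expand hr r
  -- choose the best class and orient it downwards
  have orient : ∀ {uᵢ uⱼ : EuclideanSpace ℝ (Fin 3)}, uᵢ ∈ fccSlots → uⱼ ∈ fccSlots → uᵢ ≠ uⱼ →
      0 < ⟪A uᵢ, n⟫_ℝ → 0 < ⟪A uⱼ, n⟫_ℝ →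
      3 * (1 - t ^ 2) ≤ 4 * ⟪A (uᵢ - uⱼ), e₃⟫_ℝ ^ 2 →
      ∃ uᵢ' ∈ fccSlots, ∃ uⱼ' ∈ fccSlots, uᵢ' ≠ uⱼ' ∧ 0 < ⟪A uᵢ', n⟫_ℝ ∧ 0 < ⟪A uⱼ', n⟫_ℝ ∧
        Real.sqrt 3 / 2 * Real.sqrt (1 - t ^ 2) ≤ -⟪A (uᵢ' - uⱼ'), e₃⟫_ℝ := by
    intro uᵢ uⱼ hi hj hij hip hjp hsq
    have habs : Real.sqrt 3 * Real.sqrt (1 - t ^ 2) ≤ 2 * |⟪A (uᵢ - uⱼ), e₃⟫_ℝ| :=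
      sqrt_three_mul_sqrt_le_two_abs hsq
    by_cases hsgn : ⟪A (uᵢ - uⱼ), e₃⟫_ℝ ≤ 0
    · refine ⟨uᵢ, hi, uⱼ, hj, hij, hip, hjp, ?_⟩
      rw [abs_of_nonpos hsgn] at habs; linarith
    · push Not at hsgn
      refine ⟨uⱼ, hj, uᵢ, hi, hij.symm, hjp, hip, ?_⟩
      have e : ⟪A (uⱼ - uᵢ), e₃⟫_ℝ = -⟪A (uᵢ - uⱼ), e₃⟫_ℝ := by
        rw [← neg_sub, map_neg, inner_neg_left]
      rw [abs_of_pos hsgn] at habs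
      rw [e]; linarith
  rw [← ht]
  rcases sq_sub_mul_add_sq_le_cases x y with h | h | h
  · exact orient hu₁ hu₂ d12 p₁ p₂ (by rw [hx']; linarith)
  · exact orient hu₁ hu₃ d13 p₁ p₃ (by rw [hy']; linarith)
  · refine orient hu₂ hu₃ d23 p₂ p₃ ?_
    rw [hz']
    have e : (y - x) ^ 2 = (x - y) ^ 2 := by ring
    rw [e]; linarith

end Summit.Ventures.Crystal3D.Theorems

end
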